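import Literature.Analysis.Complex.CauchyTransformHolderInterior
import HarnessLib

/-!
# The a priori `C^{1,r}` estimate for the Cauchy transform of densities supported in a disc

Topic `Literature/Analysis/Complex`. Let `F` be a complex Banach space, `0 < r < 1`, `ρ > 0`.
There is a constant `C = C(r, ρ)` such that for every smooth density `g : ℂ → F` vanishing on
`{ρ ≤ ‖z‖}`, with `‖g‖ ≤ K₀` and `‖g z - g z'‖ ≤ K₁ ‖z - z'‖ ^ r`, the Cauchy transform
`T g = cauchyTransformAlong 1 g` (`(T g)(z) = ∫ (π t)⁻¹ g(z - t) dA(t)`, the solution of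
`∂̄ (T g) = g`, Hörmander Thm. 1.2.2) satisfies

  `‖T g‖_∞ ≤ C K₀`, `‖D(T g)‖_∞ ≤ C (K₀ + K₁)`, `[D(T g)]_r ≤ C (K₀ + K₁)`

(`cauchyTransform_holder_apriori`). This is the smooth-density form of Vekua's theorem that `T`
maps `C^{0,r}` densities with support in a fixed disc boundedly into `C^{1,r}_b`
(I. N. Vekua, *Generalized analytic functions* (1962), Thm. 1.32); the general `C^{0,r}` case
follows by mollification.

Proof: the sup bound is elementary (`norm_cauchyTransform_le_uniform`); the Hölder bound for
`D(T g)` inside `B(0, 6ρ)` is `holder_fderiv_cauchyTransform_interior` (Schauder estimate for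
`Δ (T (χ T g ∘ conj))`); outside `B(0, 4ρ)` the transform is holomorphic and the Cauchy estimates
give `‖(T g)'‖ ≤ 12 K₀`, `‖(T g)''‖ ≤ 12 K₀ / ρ`; pairs at distance `≥ ρ` are handled by the sup
bound of `D(T g)`.

## References

* I. N. Vekua, *Generalized analytic functions* (1962), Thm. 1.32.
* L. Hörmander, *An Introduction to Complex Analysis in Several Variables* (1973), Thm. 1.2.2.
  [HormanderSCV1973]
* D. Gilbarg, N. S. Trudinger, *Elliptic Partial Differential Equations of Second Order* (2001),
  Thm. 4.8. [GilbargTrudinger2001]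
-/

noncomputable section

open scoped ContDiff Topology Real NNReal
open Set Metric MeasureTheory Filter Complex

namespace Literature.Analysis.Complex

/-- **A priori `C^{1,r}` estimate for the Cauchy transform** (Vekua (1962), Thm. 1.32, for
smooth densities). For `0 < r < 1` and `ρ > 0` there is `C ≥ 0` such that for every smooth
`g : ℂ → F` vanishing on `{ρ ≤ ‖z‖}` with `‖g‖ ≤ K₀` and `‖g z - g z'‖ ≤ K₁ ‖z - z'‖ ^ r`:
`‖T g‖ ≤ C K₀`, `‖D(T g)‖ ≤ C (K₀ + K₁)` and
`‖D(T g)(z) - D(T g)(z')‖ ≤ C (K₀ + K₁) ‖z - z'‖ ^ r` everywhere, where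
`T g = cauchyTransformAlong 1 g` is the Cauchy transform (`∂̄ (T g) = g`). [folklore] -/
theorem cauchyTransform_holder_apriori (F : Type) [NormedAddCommGroup F] [NormedSpace ℂ F]
    [CompleteSpace F] {r : ℝ≥0} (hr : 0 < r) (hr1 : r < 1) :
    ∀ ρ : ℝ, 0 < ρ → ∃ C : ℝ, 0 ≤ C ∧ ∀ g : ℂ → F, ContDiff ℝ ∞ g → (∀ z, ρ ≤ ‖z‖ → g z = 0) →
      ∀ K₀ K₁ : ℝ, 0 ≤ K₀ → 0 ≤ K₁ → (∀ z, ‖g z‖ ≤ K₀) →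
        (∀ z z', ‖g z - g z'‖ ≤ K₁ * ‖z - z'‖ ^ (r : ℝ)) →
        (∀ z, ‖cauchyTransformAlong (1 : ℂ) g z‖ ≤ C * K₀) ∧
        (∀ z, ‖fderiv ℝ (cauchyTransformAlong (1 : ℂ) g) z‖ ≤ C * (K₀ + K₁)) ∧
        (∀ z z', ‖fderiv ℝ (cauchyTransformAlong (1 : ℂ) g) z -
            fderiv ℝ (cauchyTransformAlong (1 : ℂ) g) z'‖ ≤
              C * (K₀ + K₁) * ‖z - z'‖ ^ (r : ℝ)) := by
  intro ρ hρ
  have hr0 : (0 : ℝ) ≤ r := r.coe_nonneg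
  have hr1' : (r : ℝ) ≤ 1 := by exact_mod_cast hr1.le
  obtain ⟨C₁, hC₁, hint⟩ := holder_fderiv_cauchyTransform_interior (F := F) hr hr1 hρ
  -- the constants
  have hρr : 0 ≤ ρ⁻¹ ^ (r : ℝ) := by positivity
  have h4ρ : 0 ≤ (4 * ρ) ^ (r : ℝ) := by positivity
  set SD : ℝ := 12 + C₁ * (4 * ρ) ^ (r : ℝ) with hSD
  have hSD0 : 0 ≤ SD := by positivity
  have hSDρ : 0 ≤ SD * ρ⁻¹ ^ (r : ℝ) := mul_nonneg hSD0 hρr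
  refine ⟨6 * ρ + SD + 2 * SD * ρ⁻¹ ^ (r : ℝ) + 12 * ρ⁻¹ ^ (r : ℝ) + C₁, by positivity, ?_⟩
  intro g hg hg0 K₀ K₁ hK₀ hK₁ hgb hgH
  have hgc : Continuous g := hg.continuous
  have hsupp := norm_lt_of_ne_zero_of_eq_zero_of_le_norm hg0
  have hint' := hint g hg hg0 K₀ K₁ hK₀ hK₁ hgb hgH
  set G : ℂ → F := cauchyTransformAlong 1 g with hGdef
  have hdiff : ∀ z, ρ < ‖z‖ → DifferentiableAt ℂ G z := fun z hz =>
    differentiableAt_cauchyTransform_exterior hgc hg0 hz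
  -- (1) the sup bound
  have h1 : ∀ z, ‖G z‖ ≤ 6 * ρ * K₀ := norm_cauchyTransform_le_uniform hρ.le hK₀ hsupp hgb
  -- (2) the sup bound for the derivative
  have hDfar : ∀ z, 2 * ρ ≤ ‖z‖ → ‖fderiv ℝ G z‖ ≤ 12 * K₀ := fun z hz =>
    (norm_fderiv_real_le_of_differentiableAt (hdiff z (by linarith))).trans
      (norm_deriv_cauchyTransform_le hgc hρ hK₀ hg0 hgb hz)
  have hD : ∀ z, ‖fderiv ℝ G z‖ ≤ SD * (K₀ + K₁) := by
    intro z
    by_cases hz : 2 * ρ ≤ ‖z‖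
    · calc ‖fderiv ℝ G z‖ ≤ 12 * K₀ := hDfar z hz
        _ ≤ SD * (K₀ + K₁) := by
            rw [hSD]
            nlinarith [mul_nonneg (mul_nonneg hC₁ h4ρ) (add_nonneg hK₀ hK₁)]
    · have hz2 : ‖z‖ < 2 * ρ := lt_of_not_ge hz
      set z₀ : ℂ := ((2 * ρ : ℝ) : ℂ) with hz₀def
      have hz₀ : ‖z₀‖ = 2 * ρ := by
        rw [hz₀def, Complex.norm_real, Real.norm_of_nonneg (by positivity)]
      have hzz₀ : ‖z - z₀‖ ≤ 4 * ρ := by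
        refine (norm_sub_le _ _).trans ?_
        rw [hz₀]
        linarith
      have hH := hint' z z₀ (by linarith) (by rw [hz₀]; linarith)
      calc ‖fderiv ℝ G z‖ ≤ ‖fderiv ℝ G z₀‖ + ‖fderiv ℝ G z - fderiv ℝ G z₀‖ :=
            norm_le_norm_add_norm_sub' _ _
        _ ≤ 12 * K₀ + C₁ * (K₀ + K₁) * ‖z - z₀‖ ^ (r : ℝ) :=
            add_le_add (hDfar z₀ (by rw [hz₀])) hH
        _ ≤ 12 * (K₀ + K₁) + C₁ * (K₀ + K₁) * (4 * ρ) ^ (r : ℝ) := by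
            gcongr
            linarith
        _ = SD * (K₀ + K₁) := by rw [hSD]; ring
  refine ⟨fun z => ?_, fun z => ?_, fun z z' => ?_⟩
  · calc ‖G z‖ ≤ 6 * ρ * K₀ := h1 z
      _ ≤ _ := by
          gcongr
          linarith
  · calc ‖fderiv ℝ G z‖ ≤ SD * (K₀ + K₁) := hD z
      _ ≤ _ := by
          gcongr
          linarith
  · by_cases hfar : ρ ≤ ‖z - z'‖
    · -- pairs at distance `≥ ρ`: the sup bound
      have hone : 1 ≤ ρ⁻¹ ^ (r : ℝ) * ‖z - z'‖ ^ (r : ℝ) := by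
        rw [← Real.mul_rpow (inv_nonneg.2 hρ.le) (norm_nonneg _)]
        refine Real.one_le_rpow ?_ hr0
        rw [inv_mul_eq_div, one_le_div hρ]
        exact hfar
      calc ‖fderiv ℝ G z - fderiv ℝ G z'‖ ≤ ‖fderiv ℝ G z‖ + ‖fderiv ℝ G z'‖ := norm_sub_le _ _
        _ ≤ SD * (K₀ + K₁) + SD * (K₀ + K₁) := add_le_add (hD z) (hD z')
        _ = 2 * SD * (K₀ + K₁) * 1 := by ring
        _ ≤ 2 * SD * (K₀ + K₁) * (ρ⁻¹ ^ (r : ℝ) * ‖z - z'‖ ^ (r : ℝ)) := by gcongr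
        _ = (2 * SD * ρ⁻¹ ^ (r : ℝ)) * (K₀ + K₁) * ‖z - z'‖ ^ (r : ℝ) := by ring
        _ ≤ _ := by
            gcongr
            linarith
    · have hlt : ‖z - z'‖ < ρ := lt_of_not_ge hfar
      have hmin : ‖z - z'‖ ≤ ρ ^ (1 - (r : ℝ)) * ‖z - z'‖ ^ (r : ℝ) := by
        have h := min_le_rpow_mul_rpow (norm_nonneg (z - z')) hρ hr0 hr1'
        rwa [min_eq_left hlt.le] at h
      have hρpow : ρ⁻¹ * ρ ^ (1 - (r : ℝ)) = ρ⁻¹ ^ (r : ℝ) := by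
        rw [Real.rpow_sub hρ, Real.rpow_one, Real.inv_rpow hρ.le]
        field_simp
      by_cases hz' : 4 * ρ ≤ ‖z'‖
      · -- both points in the exterior region: Cauchy estimates and the mean value inequality
        have hz3 : 3 * ρ < ‖z‖ := by
          have := norm_sub_norm_le z' z
          rw [norm_sub_rev] at this
          linarith
        calc ‖fderiv ℝ G z - fderiv ℝ G z'‖ ≤ ‖deriv G z - deriv G z'‖ :=
              norm_fderiv_real_sub_le_of_differentiableAt (hdiff z (by linarith))
                (hdiff z' (by linarith))
          _ ≤ 12 * K₀ / ρ * ‖z - z'‖ :=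
              norm_deriv_cauchyTransform_sub_le hgc hρ hK₀ hg0 hgb hz' hlt
          _ ≤ 12 * K₀ / ρ * (ρ ^ (1 - (r : ℝ)) * ‖z - z'‖ ^ (r : ℝ)) :=
              mul_le_mul_of_nonneg_left hmin (by positivity)
          _ = 12 * (ρ⁻¹ * ρ ^ (1 - (r : ℝ))) * K₀ * ‖z - z'‖ ^ (r : ℝ) := by ring
          _ = 12 * ρ⁻¹ ^ (r : ℝ) * K₀ * ‖z - z'‖ ^ (r : ℝ) := by rw [hρpow]
          _ ≤ _ := by
              gcongr
              · linarith
              · linarith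
      · -- both points in `B(0, 6ρ)`: the interior estimate
        have hz'4 : ‖z'‖ < 4 * ρ := lt_of_not_ge hz'
        have hz5 : ‖z‖ < 5 * ρ := by
          have := norm_sub_norm_le z z'
          linarith
        calc ‖fderiv ℝ G z - fderiv ℝ G z'‖ ≤ C₁ * (K₀ + K₁) * ‖z - z'‖ ^ (r : ℝ) :=
              hint' z z' (by linarith) (by linarith)
          _ ≤ _ := by
              gcongr
              linarith

/-- The a priori estimate in the packaged form `CauchyTransformHolderApriori F r` of
`Literature/Analysis/Complex/CauchyTransformHolderExtension.lean` (the hypothesis of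
`cauchyTransform_holder_of_apriori`, which extends the three bounds to continuous `r`-Hölder
densities). [folklore] -/
theorem cauchyTransformHolderApriori_of_lt_one (F : Type) [NormedAddCommGroup F]
    [NormedSpace ℂ F] [CompleteSpace F] {r : ℝ≥0} (hr : 0 < r) (hr1 : r < 1) :
    CauchyTransformHolderApriori F r :=
  cauchyTransform_holder_apriori F hr hr1

end Literature.Analysis.Complex
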